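import Literature.Probability.RandomPlanarGeometry.HexSAWSurfaceWallBridges
import Literature.Probability.RandomPlanarGeometry.HexSAWArmchairWallBridges
import HarnessLib

/-!
# Honeycomb SAW at the Duminil-Copin–Smirnov surface (brick-wall frame): `β(y) > √y` STRICTLY, for every `y > 0`
# (`y⁴ + y² ≤ y · B^w_6(y) ≤ β(y)⁸`)

Topic `Literature/Probability/RandomPlanarGeometry` (lane «pcv-sawmu», rider «WALL-SQRT-STRICT» — the DCS-frame twin of
`HexSAWArmchairSqrtStrict.lean` and the companion of `HexSAWSurfaceSqrtAsymptotic.lean` (`β(y) ≤ √y/(1 − 36/√y)`); continues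
`HexSAWSurfaceWallBridges.lean` (S1 Part I) — `wbr`, `WB`, `visits` (even times `i ≥ 1` with `Y_i = 0`), the Fekete rate `wallRate y = β(y)` with
`wallSeq_le_pow : d_k ≤ (β²)^k`, `d_k = y · B^w_{2k-2}(y)`; `Arm.pt`, `brickWallGraph_adj_coord` via `HexSAWArmchairWallBridges.lean`).

Sources. N. R. Beaton, M. Bousquet-Mélou, J. de Gier, H. Duminil-Copin, A. J. Guttmann, CMP 326 (2014) = arXiv:1109.0358v5, §3.1, Proposition 5
(p. 9: "for any `y > 0`, `μ(y) ≥ max(μ, √y)`"; pp. 9–10: "the lower bound `μ(y) ≥ √y` is obtained by counting zig-zag walks sticking to the surface").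
N. Madras, G. Slade, *The Self-Avoiding Walk* (1993), §1.2 ((1.2.17) p. 11).  I. G. Enting, I. Jensen, LNP 775 (2009), §7.4.2, Fig. 7.10 (brickwork
form of the honeycomb lattice).

## What is proved (namespace `…SAW.HexBW.Wall`)

The two DCS-frame wall bridges of length `6` — the straight walk `Six.sw = (0,0),(1,0),…,(6,0)` (3 surface visits) and the dip
`Six.dw = (0,0),(1,0),(1,−1),(2,−1),(3,−1),(3,0),(4,0)` (1 surface visit) — give **`pow_add_pow_le_WB_six : y³ + y ≤ B^w_6(y)`** (`y ≥ 0`; in fact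
equality: these are the only two), hence by Fekete (`d_4 = y · B^w_6 ≤ (β²)⁴`) **`pow_add_pow_le_wallRate_pow : y⁴ + y² ≤ β(y)⁸`** and
**`sqrt_lt_wallRate : √y < β(y)`** for EVERY `y > 0` — BBdGDCG's printed `μ(y) ≥ √y` is strict throughout (by the HOME identification
`wallRate_eq_surfaceMu` of a-idea-1 g21, `β(y)` is Prop. 5's `μ(y)`); quantitatively `β(y) ≥ √y · (1 + y⁻²)^{1/8}` (`wallRate_pow_eight_ge`).

Status in print: BBdGDCG print the weak inequality only (Prop. 5, p. 9); LABEL (author's proposal): CONSOLIDATION + XS (strict form of a printed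
inequality by two explicit walks).  Coordinates, bonds, injectivity, the `X`-monotonicity and the visit counts are checked by `decide`; the Finset
memberships are discharged inline (design note in `HexSAWArmchairWallBridgeOddRate.lean`).
-/

noncomputable section

open Finset Filter Function
open Literature.Probability.LatticeModels Literature.Probability.Percolation SimpleGraph
open _root_.Topology

namespace Literature.Probability.RandomPlanarGeometry.SAW.HexBW.Wall

variable {y : ℝ}

namespace Six

/-- Brick-wall adjacency as a Boolean test on coordinates. [cite: EntingJensen2009, §7.4.2, Fig. 7.10 (brickwork form of the honeycomb lattice)] -/
def adjS (a b c d : ℤ) : Bool :=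
  ((c = a + 1 ∨ a = c + 1) ∧ d = b) ∨ (c = a ∧ ((d = b + 1 ∧ (a + b) % 2 = 0) ∨ (b = d + 1 ∧ (c + d) % 2 = 0)))

/-- The Boolean test is sound. [cite: EntingJensen2009, §7.4.2, Fig. 7.10 (brickwork form of the honeycomb lattice)] -/
private theorem adj_of_adjS {a b c d : ℤ} (h : adjS a b c d = true) : brickWallGraph.Adj (Arm.pt a b) (Arm.pt c d) := by
  rw [brickWallGraph_adj_coord]
  simpa [adjS, Arm.pt_apply_zero, Arm.pt_apply_one] using h

/-- `X`-coordinates of the straight walk (frozen value `6` after time 6). [cite: BeatonBousquetMelouDeGierDuminilCopinGuttmann2014, §3.1 (arXiv v5 p. 9: walks sticking to the surface)] -/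
def sX : ℕ → ℤ
  | 0 => 0 | 1 => 1 | 2 => 2 | 3 => 3 | 4 => 4 | 5 => 5 | _ => 6

/-- `X`-coordinates of the dip (frozen value `4` after time 6). [cite: EntingJensen2009, §7.4.2, Fig. 7.10] -/
def dX : ℕ → ℤ
  | 0 => 0 | 1 => 1 | 2 => 1 | 3 => 2 | 4 => 3 | 5 => 3 | _ => 4

/-- `Y`-coordinates of the dip (frozen value `0` after time 6). [cite: EntingJensen2009, §7.4.2, Fig. 7.10] -/
def dY : ℕ → ℤ
  | 2 => -1 | 3 => -1 | 4 => -1 | _ => 0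

/-- **The straight 6-step walk along the surface** (surface visits at times 2, 4, 6). [cite: BeatonBousquetMelouDeGierDuminilCopinGuttmann2014, §3.1 (arXiv v5 p. 9: walks sticking to the surface)] -/
def sw (i : ℕ) : Site 2 := Arm.pt (sX (min i 6)) 0

/-- **The 6-step dip** `(0,0),(1,0),(1,−1),(2,−1),(3,−1),(3,0),(4,0)` (one surface visit, at time 6). [cite: EntingJensen2009, §7.4.2, Fig. 7.10] -/
def dw (i : ℕ) : Site 2 := Arm.pt (dX (min i 6)) (dY (min i 6))

/-- Coordinate facts of the straight walk, by `decide`. [cite: EntingJensen2009, §7.4.2, Fig. 7.10] -/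
theorem s_facts : (∀ i < 6, adjS (sX i) 0 (sX (i + 1)) 0 = true) ∧ (∀ i ≤ 6, ∀ j ≤ 6, sX i = sX j → i = j) ∧
    (∀ i ≤ 6, sX 0 ≤ sX i ∧ sX i ≤ sX 6) ∧ sX 0 = 0 := by decide

/-- Coordinate facts of the dip, by `decide`. [cite: EntingJensen2009, §7.4.2, Fig. 7.10] -/
theorem d_facts : (∀ i < 6, adjS (dX i) (dY i) (dX (i + 1)) (dY (i + 1)) = true) ∧
    (∀ i ≤ 6, ∀ j ≤ 6, dX i = dX j → dY i = dY j → i = j) ∧ (∀ i ≤ 6, dY i ≤ 0) ∧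
    (∀ i ≤ 6, dX 0 ≤ dX i ∧ dX i ≤ dX 6) ∧ dX 0 = 0 ∧ dY 0 = 0 ∧ dY 6 = 0 := by decide

/-- Membership components of the straight walk (`∀`/`∧`/`=` form). [cite: MadrasSlade1993, §1.2, Definition 1.2.1 (bridges); BeatonBousquetMelouDeGierDuminilCopinGuttmann2014, §3.1 (arXiv v5 p. 9)] -/
theorem sw_components : sw 0 = 0 ∧ (∀ i, 6 ≤ i → sw i = sw 6) ∧ IsBW 6 sw ∧ Set.InjOn sw {i | i ≤ 6} ∧ InHP 6 sw ∧ IsArch 6 sw ∧ IsWB 6 sw := by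
  obtain ⟨hadj, hinj, hmono, hX0⟩ := s_facts
  refine ⟨?_, fun i hi => by simp only [sw, min_eq_right hi, min_self], fun i hi => ?_, fun i hi j hj hij => ?_, fun i _ => ?_, ⟨by norm_num, rfl⟩,
    fun i hi => ?_⟩
  · rw [site_two_eq_iff]; simp only [sw, Nat.zero_min, Arm.pt_apply_zero, Arm.pt_apply_one, hX0]; exact ⟨rfl, rfl⟩
  · simp only [sw, min_eq_left hi.le, min_eq_left (Nat.succ_le_of_lt hi)]; exact adj_of_adjS (hadj i hi)
  · simp only [Set.mem_setOf_eq] at hi hj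
    have h0 := congrFun hij 0
    simp only [sw, Arm.pt_apply_zero, min_eq_left hi, min_eq_left hj] at h0
    exact hinj i hi j hj h0
  · simp only [sw, Arm.pt_apply_one]; exact le_rfl
  · simp only [sw, Arm.pt_apply_zero, Nat.zero_min, min_self, min_eq_left hi]; exact hmono i hi

/-- Membership components of the dip. [cite: MadrasSlade1993, §1.2, Definition 1.2.1 (bridges); EntingJensen2009, §7.4.2, Fig. 7.10] -/
theorem dw_components : dw 0 = 0 ∧ (∀ i, 6 ≤ i → dw i = dw 6) ∧ IsBW 6 dw ∧ Set.InjOn dw {i | i ≤ 6} ∧ InHP 6 dw ∧ IsArch 6 dw ∧ IsWB 6 dw := by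
  obtain ⟨hadj, hinj, hY, hmono, hX0, hY0, hY6⟩ := d_facts
  refine ⟨?_, fun i hi => by simp only [dw, min_eq_right hi, min_self], fun i hi => ?_, fun i hi j hj hij => ?_, fun i hi => ?_,
    ⟨by norm_num, ?_⟩, fun i hi => ?_⟩
  · rw [site_two_eq_iff]; simp only [dw, Nat.zero_min, Arm.pt_apply_zero, Arm.pt_apply_one, hX0, hY0]; exact ⟨rfl, rfl⟩
  · simp only [dw, min_eq_left hi.le, min_eq_left (Nat.succ_le_of_lt hi)]; exact adj_of_adjS (hadj i hi)
  · simp only [Set.mem_setOf_eq] at hi hj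
    have h0 := congrFun hij 0
    have h1 := congrFun hij 1
    simp only [dw, Arm.pt_apply_zero, Arm.pt_apply_one, min_eq_left hi, min_eq_left hj] at h0 h1
    exact hinj i hi j hj h0 h1
  · simp only [dw, Arm.pt_apply_one, min_eq_left hi]; exact hY i hi
  · simp only [dw, Arm.pt_apply_one, min_self]; exact hY6
  · simp only [dw, Arm.pt_apply_zero, Nat.zero_min, min_self, min_eq_left hi]; exact hmono i hi

/-- Surface visits of the two walks: `3` and `1` (kernel evaluation). [cite: BeatonBousquetMelouDeGierDuminilCopinGuttmann2014, §3.1 (arXiv v5 p. 8: "the number of contacts with the surface")] -/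
theorem visits_sw_dw : visits 6 sw = 3 ∧ visits 6 dw = 1 := by decide

/-- The two walks differ (at time `2`: `(2,0)` versus `(1,−1)`). [cite: EntingJensen2009, §7.4.2, Fig. 7.10] -/
theorem sw_ne_dw : sw ≠ dw := fun h => by
  have := congrFun (congrFun h 2) 0
  revert this
  decide

end Six

open Six in
/-- **`y³ + y ≤ B^w_6(y)`** (`y ≥ 0`): the straight walk and the dip are two distinct DCS-frame wall bridges of length `6` with `3` and `1` surface
visits. [cite: BeatonBousquetMelouDeGierDuminilCopinGuttmann2014, §3.1, Proposition 5 (arXiv v5 p. 9: "μ(y) ≥ max(μ, √y)")] -/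
theorem pow_add_pow_le_WB_six (hy : 0 ≤ y) : y ^ 3 + y ≤ WB 6 y := by
  classical
  rw [WB]
  have hsub : ({sw, dw} : Finset (ℕ → Site 2)) ⊆ wbr 6 := by
    refine Finset.insert_subset_iff.2 ⟨?_, Finset.singleton_subset_iff.2 ?_⟩
    · rw [mem_wbr, mem_archs, mem_hpw, mem_saws_iff]
      obtain ⟨h0, hfr, hbw, hinj, hH, harch, hwb⟩ := sw_components
      exact ⟨⟨⟨⟨h0, hfr, hbw, hinj⟩, hH⟩, harch⟩, hwb⟩
    · rw [mem_wbr, mem_archs, mem_hpw, mem_saws_iff]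
      obtain ⟨h0, hfr, hbw, hinj, hH, harch, hwb⟩ := dw_components
      exact ⟨⟨⟨⟨h0, hfr, hbw, hinj⟩, hH⟩, harch⟩, hwb⟩
  obtain ⟨h3, h1⟩ := visits_sw_dw
  have hpair : ∑ ω ∈ ({sw, dw} : Finset (ℕ → Site 2)), y ^ visits 6 ω = y ^ 3 + y := by
    simp only [Finset.sum_pair sw_ne_dw, h3, h1, pow_one]
  calc y ^ 3 + y = ∑ ω ∈ ({sw, dw} : Finset (ℕ → Site 2)), y ^ visits 6 ω := hpair.symm
    _ ≤ ∑ ω ∈ wbr 6, y ^ visits 6 ω := Finset.sum_le_sum_of_subset_of_nonneg hsub fun _ _ _ => pow_nonneg hy _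

/-- **`y⁴ + y² ≤ β(y)⁸`** (`y > 0`): `d_4 = y · B^w_6 ≤ (β²)⁴`. [cite: MadrasSlade1993, §1.2, (1.2.17) (p. 11: b_n ≤ μ_Bridge^n)] -/
theorem pow_add_pow_le_wallRate_pow (hy : 0 < y) : y ^ 4 + y ^ 2 ≤ wallRate y ^ 8 := by
  have h := wallSeq_le_pow hy 4
  rw [wallSeq, if_neg (by norm_num), show 2 * 4 - 2 = 6 by norm_num, ← pow_mul, show 2 * 4 = 8 by norm_num] at h
  calc y ^ 4 + y ^ 2 = y * (y ^ 3 + y) := by ring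
    _ ≤ y * WB 6 y := mul_le_mul_of_nonneg_left (pow_add_pow_le_WB_six hy.le) hy.le
    _ ≤ wallRate y ^ 8 := h

/-- **`√y < β(y)` for EVERY `y > 0`**: BBdGDCG's `μ(y) ≥ √y` is strict. [cite: BeatonBousquetMelouDeGierDuminilCopinGuttmann2014, §3.1, Proposition 5 (arXiv v5 p. 9: "μ(y) ≥ max(μ, √y)" — strict form)] -/
theorem sqrt_lt_wallRate (hy : 0 < y) : Real.sqrt y < wallRate y := by
  have hβ := wallRate_pos y
  have h1 : Real.sqrt y ^ 8 < wallRate y ^ 8 := by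
    calc Real.sqrt y ^ 8 = y ^ 4 := by rw [show (8 : ℕ) = 2 * 4 by norm_num, pow_mul, Real.sq_sqrt hy.le]
      _ < y ^ 4 + y ^ 2 := lt_add_of_pos_right _ (pow_pos hy 2)
      _ ≤ wallRate y ^ 8 := pow_add_pow_le_wallRate_pow hy
  exact lt_of_pow_lt_pow_left₀ 8 hβ.le h1

/-- **Quantitative form**: `y⁴ (1 + y⁻²) ≤ β(y)⁸`, i.e. `β(y) ≥ √y · (1 + y⁻²)^{1/8}`. [cite: BeatonBousquetMelouDeGierDuminilCopinGuttmann2014, §3.1, Proposition 5 (arXiv v5 p. 9)] -/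
theorem wallRate_pow_eight_ge (hy : 0 < y) : y ^ 4 * (1 + (y ^ 2)⁻¹) ≤ wallRate y ^ 8 := by
  have hy2 : y ^ 2 ≠ 0 := pow_ne_zero _ hy.ne'
  have e : y ^ 4 * (1 + (y ^ 2)⁻¹) = y ^ 4 + y ^ 2 := by
    rw [mul_add, mul_one, ← div_eq_mul_inv, show y ^ 4 / y ^ 2 = y ^ 2 from by rw [div_eq_iff hy2]; ring]
  rw [e]
  exact pow_add_pow_le_wallRate_pow hy

end Literature.Probability.RandomPlanarGeometry.SAW.HexBW.Wall
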